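import Summits.NavierStokesRegularity.OSWSelfSimilar.SheetRTestSpace
import HarnessLib

/-!
# SHEET-ℝ frame, MODEL ASSEMBLY layer 3c: the linearised weak form against a FIXED compactly supported test is a bounded linear
# functional of the energy-class profile

HONEST FRAMING (cell ns-blowup GROUP B / zone Z3, cases Z3-SR-CERT / Z3-SR-SPEC; 1-D MODEL certificate frame (viscous gCLM/OSW sheet on the
line); not Euler/NS; «violates: none — MODEL»). Nothing here asserts that a profile exists.

Lions' hypothesis `hE` («`u ↦ E(u, φ)` is bounded for each FIXED test `φ`») for the sheet's linearised form
`linForm L d V u u₁ v v₁ = ∫ [w u₁v₁ + 2ξ u₁v + w d u₁v + w V uv]` (`SheetRLinearisedTests`), drift `|d| ≤ D₀ + D₁|ξ|`, potential `|V| ≤ V₀`: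
writing the integrand as `w·u₁·v₁ + w·u₁·(2ξv/w) + w·u₁·(d v) + w·u·(V v)`, each term is a weighted product of an energy-class factor
(`u₁` or `u`, in `L²_w`) with a FIXED `L²_w` function built from the test (`v₁`, `2ξv/w`, `d v`, `V v` — all in `L²_w` because the test is
bounded with compact support), so the weighted Cauchy–Schwarz inequality of `SheetREnergyClass` gives integrability and

  `|linForm(u; v)| ≤ ‖u₁‖_w·(‖v₁‖_w + ‖2ξv/w‖_w + ‖d v‖_w) + ‖u‖_w·‖V v‖_w`        (`abs_linForm_le`),

together with additivity/homogeneity of `linForm` in the profile slot and in the test slot on these classes (`linForm_add_left`, …) and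
invariance under a.e. modification of the profile (`linForm_congr_ae`).  Pure calculus; no definition, no named fact.
WHAT THIS IS NOT: not NS; no number of record moves.
-/

noncomputable section

namespace Summit.NavierStokesRegularity.OSWSelfSimilar
namespace SheetRLinearisedFormBounds

open _root_.MeasureTheory _root_.Set _root_.Filter _root_.Real SheetRWeakProfilePV SheetRWeakToStrong SheetREnergyClass SheetRWeightedMeasure
  SheetRLinearisedTests SheetREnergySpace SheetRTestSpace
open scoped Topology ENNReal

section Fixed

variable {L D₀ D₁ V₀ : ℝ} {d V : ℝ → ℝ}

/-- **The four test-side weights are in `L²_w`.** For a test `(v, v₁)` and coefficients `|d| ≤ D₀ + D₁|ξ|`, `|V| ≤ V₀` (a.e.-strongly measurable):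
`v₁`, `2ξv/w`, `d·v`, `V·v` are a.e.-strongly measurable with `∫ w(·)² < ∞`. [folklore] -/
theorem testWeights {v v₁ : ℝ → ℝ} (hL : 0 < L) (hdm : AEStronglyMeasurable d volume) (hVm : AEStronglyMeasurable V volume)
    (hD₁ : 0 ≤ D₁) (hd : ∀ ξ, |d ξ| ≤ D₀ + D₁ * |ξ|) (hV : ∀ ξ, |V ξ| ≤ V₀) (h : IsCompactTest v v₁) :
    (AEStronglyMeasurable v₁ volume ∧ Integrable fun y => (L ^ 2 + y ^ 2) * v₁ y ^ 2) ∧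
    (AEStronglyMeasurable (fun y => 2 * y * v y / (L ^ 2 + y ^ 2)) volume ∧
      Integrable fun y => (L ^ 2 + y ^ 2) * (2 * y * v y / (L ^ 2 + y ^ 2)) ^ 2) ∧
    (AEStronglyMeasurable (fun y => d y * v y) volume ∧ Integrable fun y => (L ^ 2 + y ^ 2) * (d y * v y) ^ 2) ∧
    (AEStronglyMeasurable (fun y => V y * v y) volume ∧ Integrable fun y => (L ^ 2 + y ^ 2) * (V y * v y) ^ 2) := by
  obtain ⟨hc, -, -, B, hB0, hB⟩ := basic_of_isCompactTest h
  obtain ⟨hwv, hwv₁⟩ := weighted_of_isCompactTest (L := L) h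
  obtain ⟨R, hR⟩ := h.support
  have hw : ∀ y : ℝ, 0 < L ^ 2 + y ^ 2 := fun y => by positivity
  have hwm : AEStronglyMeasurable (fun y : ℝ => L ^ 2 + y ^ 2) volume := by fun_prop
  have hvm : AEStronglyMeasurable v volume := hc.aestronglyMeasurable
  have hgc : Continuous fun y => 2 * y * v y / (L ^ 2 + y ^ 2) :=
    ((continuous_const.mul continuous_id).mul hc).div (by fun_prop) fun y => (hw y).ne'
  refine ⟨⟨h.memLp.1, hwv₁⟩, ⟨hgc.aestronglyMeasurable, ?_⟩, ⟨hdm.mul hvm, ?_⟩, ⟨hVm.mul hvm, ?_⟩⟩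
  · -- `w (2ξv/w)² = 4ξ²v²/w ≤ 4v² ≤ (4/L²) w v²`
    refine (hwv.const_mul (4 / L ^ 2)).mono' (hwm.mul (hgc.aestronglyMeasurable.pow 2)) (Eventually.of_forall fun y => ?_)
    rw [Real.norm_eq_abs, abs_of_nonneg (by positivity)]
    have hL2 : 0 < L ^ 2 := by positivity
    have hwy := hw y
    calc (L ^ 2 + y ^ 2) * (2 * y * v y / (L ^ 2 + y ^ 2)) ^ 2 = 4 * y ^ 2 * v y ^ 2 / (L ^ 2 + y ^ 2) := by
          field_simp
          ring
      _ ≤ 4 * v y ^ 2 := by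
          rw [div_le_iff₀ hwy]
          nlinarith [sq_nonneg L, sq_nonneg (v y), mul_nonneg (sq_nonneg L) (sq_nonneg (v y))]
      _ ≤ 4 / L ^ 2 * ((L ^ 2 + y ^ 2) * v y ^ 2) := by
          rw [div_mul_eq_mul_div, le_div_iff₀ hL2]
          nlinarith [sq_nonneg y, sq_nonneg (v y), mul_nonneg (sq_nonneg y) (sq_nonneg (v y))]
  · -- `w (d v)² ≤ (D₀ + D₁R)² w v²` (on the support `|ξ| < R`; zero outside)
    refine (hwv.const_mul ((D₀ + D₁ * |R|) ^ 2)).mono' (hwm.mul ((hdm.mul hvm).pow 2)) (Eventually.of_forall fun y => ?_)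
    rw [Real.norm_eq_abs, abs_of_nonneg (by positivity)]
    by_cases hy : R ≤ |y|
    · rw [(hR y hy).1]; simp
    · have hy' : |y| < |R| := (not_le.1 hy).trans_le (le_abs_self R)
      have hdy : |d y| ≤ D₀ + D₁ * |R| := (hd y).trans (by gcongr)
      have hdy2 : d y ^ 2 ≤ (D₀ + D₁ * |R|) ^ 2 := by
        rw [← sq_abs (d y)]; exact pow_le_pow_left₀ (abs_nonneg _) hdy 2
      calc (L ^ 2 + y ^ 2) * (d y * v y) ^ 2 = d y ^ 2 * ((L ^ 2 + y ^ 2) * v y ^ 2) := by ring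
        _ ≤ (D₀ + D₁ * |R|) ^ 2 * ((L ^ 2 + y ^ 2) * v y ^ 2) :=
            mul_le_mul_of_nonneg_right hdy2 (by positivity)
  · refine (hwv.const_mul (V₀ ^ 2)).mono' (hwm.mul ((hVm.mul hvm).pow 2)) (Eventually.of_forall fun y => ?_)
    rw [Real.norm_eq_abs, abs_of_nonneg (by positivity)]
    have hV2 : V y ^ 2 ≤ V₀ ^ 2 := by rw [← sq_abs (V y)]; exact pow_le_pow_left₀ (abs_nonneg _) (hV y) 2
    calc (L ^ 2 + y ^ 2) * (V y * v y) ^ 2 = V y ^ 2 * ((L ^ 2 + y ^ 2) * v y ^ 2) := by ring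
      _ ≤ V₀ ^ 2 * ((L ^ 2 + y ^ 2) * v y ^ 2) := mul_le_mul_of_nonneg_right hV2 (by positivity)

/-- The integrand of `linForm`, rewritten as four weighted products. [folklore] -/
theorem integrand_eq (L : ℝ) (hL : 0 < L) (d V u u₁ v v₁ : ℝ → ℝ) (y : ℝ) :
    (L ^ 2 + y ^ 2) * (u₁ y * v₁ y) + 2 * y * (u₁ y * v y) + (L ^ 2 + y ^ 2) * d y * (u₁ y * v y)
        + (L ^ 2 + y ^ 2) * V y * (u y * v y)
      = (L ^ 2 + y ^ 2) * (u₁ y * v₁ y) + (L ^ 2 + y ^ 2) * (u₁ y * (2 * y * v y / (L ^ 2 + y ^ 2)))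
        + (L ^ 2 + y ^ 2) * (u₁ y * (d y * v y)) + (L ^ 2 + y ^ 2) * (u y * (V y * v y)) := by
  have hw : (L ^ 2 + y ^ 2) ≠ 0 := by positivity
  field_simp

/-- **Integrability and the fixed-test bound.** For `u, u₁` a.e.-strongly measurable with `∫wu² < ∞`, `∫wu₁² < ∞` and a test `(v, v₁)`:
the `linForm` integrand is integrable and
`|linForm L d V u u₁ v v₁| ≤ √(∫wu₁²)·(√∫wv₁² + √∫w(2ξv/w)² + √∫w(dv)²) + √(∫wu²)·√∫w(Vv)²`. [folklore] -/
theorem abs_linForm_le {u u₁ v v₁ : ℝ → ℝ} (hL : 0 < L) (hdm : AEStronglyMeasurable d volume) (hVm : AEStronglyMeasurable V volume)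
    (hD₁ : 0 ≤ D₁) (hd : ∀ ξ, |d ξ| ≤ D₀ + D₁ * |ξ|) (hV : ∀ ξ, |V ξ| ≤ V₀) (h : IsCompactTest v v₁)
    (hum : AEStronglyMeasurable u volume) (hu₁m : AEStronglyMeasurable u₁ volume)
    (h0 : Integrable fun y => (L ^ 2 + y ^ 2) * u y ^ 2) (h1 : Integrable fun y => (L ^ 2 + y ^ 2) * u₁ y ^ 2) :
    Integrable (fun y => (L ^ 2 + y ^ 2) * (u₁ y * v₁ y) + 2 * y * (u₁ y * v y) + (L ^ 2 + y ^ 2) * d y * (u₁ y * v y)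
        + (L ^ 2 + y ^ 2) * V y * (u y * v y)) ∧
    |linForm L d V u u₁ v v₁| ≤
      Real.sqrt (∫ y, (L ^ 2 + y ^ 2) * u₁ y ^ 2) *
          (Real.sqrt (∫ y, (L ^ 2 + y ^ 2) * v₁ y ^ 2) + Real.sqrt (∫ y, (L ^ 2 + y ^ 2) * (2 * y * v y / (L ^ 2 + y ^ 2)) ^ 2)
            + Real.sqrt (∫ y, (L ^ 2 + y ^ 2) * (d y * v y) ^ 2)) +
        Real.sqrt (∫ y, (L ^ 2 + y ^ 2) * u y ^ 2) * Real.sqrt (∫ y, (L ^ 2 + y ^ 2) * (V y * v y) ^ 2) := by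
  obtain ⟨⟨hv₁m, hwv₁⟩, ⟨hgm, hwg⟩, ⟨hdvm, hwdv⟩, ⟨hVvm, hwVv⟩⟩ := testWeights hL hdm hVm hD₁ hd hV h
  have hwm : AEStronglyMeasurable (fun y : ℝ => L ^ 2 + y ^ 2) volume := by fun_prop
  -- the four weighted Cauchy–Schwarz estimates
  obtain ⟨i1, b1⟩ := integral_weight_abs_mul_le (L := L) hu₁m hv₁m h1 hwv₁
  obtain ⟨i2, b2⟩ := integral_weight_abs_mul_le (L := L) hu₁m hgm h1 hwg
  obtain ⟨i3, b3⟩ := integral_weight_abs_mul_le (L := L) hu₁m hdvm h1 hwdv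
  obtain ⟨i4, b4⟩ := integral_weight_abs_mul_le (L := L) hum hVvm h0 hwVv
  -- signed integrability of each weighted product
  have key : ∀ {f g : ℝ → ℝ}, AEStronglyMeasurable f volume → AEStronglyMeasurable g volume →
      Integrable (fun y => (L ^ 2 + y ^ 2) * |f y * g y|) → Integrable (fun y => (L ^ 2 + y ^ 2) * (f y * g y)) := by
    intro f g hf hg hi
    refine hi.mono' (hwm.mul (hf.mul hg)) (Eventually.of_forall fun y => ?_)
    rw [Real.norm_eq_abs, abs_mul, abs_of_nonneg (by positivity : (0:ℝ) ≤ L ^ 2 + y ^ 2)]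
  have j1 := key hu₁m hv₁m i1
  have j2 := key hu₁m hgm i2
  have j3 := key hu₁m hdvm i3
  have j4 := key hum hVvm i4
  have hsum : Integrable (fun y => (L ^ 2 + y ^ 2) * (u₁ y * v₁ y) + (L ^ 2 + y ^ 2) * (u₁ y * (2 * y * v y / (L ^ 2 + y ^ 2)))
      + (L ^ 2 + y ^ 2) * (u₁ y * (d y * v y)) + (L ^ 2 + y ^ 2) * (u y * (V y * v y))) := ((j1.add j2).add j3).add j4
  have heq : (fun y => (L ^ 2 + y ^ 2) * (u₁ y * v₁ y) + 2 * y * (u₁ y * v y) + (L ^ 2 + y ^ 2) * d y * (u₁ y * v y)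
      + (L ^ 2 + y ^ 2) * V y * (u y * v y)) =
      fun y => (L ^ 2 + y ^ 2) * (u₁ y * v₁ y) + (L ^ 2 + y ^ 2) * (u₁ y * (2 * y * v y / (L ^ 2 + y ^ 2)))
      + (L ^ 2 + y ^ 2) * (u₁ y * (d y * v y)) + (L ^ 2 + y ^ 2) * (u y * (V y * v y)) :=
    funext fun y => integrand_eq L hL d V u u₁ v v₁ y
  refine ⟨by rw [heq]; exact hsum, ?_⟩
  -- the bound
  have habs : ∀ {f g : ℝ → ℝ}, Integrable (fun y => (L ^ 2 + y ^ 2) * (f y * g y)) →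
      Integrable (fun y => (L ^ 2 + y ^ 2) * |f y * g y|) →
      |∫ y, (L ^ 2 + y ^ 2) * (f y * g y)| ≤ ∫ y, (L ^ 2 + y ^ 2) * |f y * g y| := by
    intro f g hi hi'
    calc |∫ y, (L ^ 2 + y ^ 2) * (f y * g y)| ≤ ∫ y, |(L ^ 2 + y ^ 2) * (f y * g y)| := by
          rw [← Real.norm_eq_abs]; exact (norm_integral_le_integral_norm _).trans (le_of_eq (by simp only [Real.norm_eq_abs]))
      _ = ∫ y, (L ^ 2 + y ^ 2) * |f y * g y| := by
          refine integral_congr_ae (Eventually.of_forall fun y => ?_)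
          show |(L ^ 2 + y ^ 2) * (f y * g y)| = (L ^ 2 + y ^ 2) * |f y * g y|
          rw [abs_mul, abs_of_nonneg (by positivity : (0:ℝ) ≤ L ^ 2 + y ^ 2)]
  have h12 : Integrable (fun y => (L ^ 2 + y ^ 2) * (u₁ y * v₁ y) + (L ^ 2 + y ^ 2) * (u₁ y * (2 * y * v y / (L ^ 2 + y ^ 2)))) :=
    j1.add j2
  have h123 : Integrable (fun y => (L ^ 2 + y ^ 2) * (u₁ y * v₁ y) + (L ^ 2 + y ^ 2) * (u₁ y * (2 * y * v y / (L ^ 2 + y ^ 2)))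
      + (L ^ 2 + y ^ 2) * (u₁ y * (d y * v y))) := h12.add j3
  unfold linForm
  rw [heq, integral_add h123 j4, integral_add h12 j3, integral_add j1 j2]
  have e1 := (habs j1 i1).trans b1
  have e2 := (habs j2 i2).trans b2
  have e3 := (habs j3 i3).trans b3
  have e4 := (habs j4 i4).trans b4
  calc |(((∫ y, (L ^ 2 + y ^ 2) * (u₁ y * v₁ y)) + ∫ y, (L ^ 2 + y ^ 2) * (u₁ y * (2 * y * v y / (L ^ 2 + y ^ 2))))
        + ∫ y, (L ^ 2 + y ^ 2) * (u₁ y * (d y * v y))) + ∫ y, (L ^ 2 + y ^ 2) * (u y * (V y * v y))|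
      ≤ ((|∫ y, (L ^ 2 + y ^ 2) * (u₁ y * v₁ y)| + |∫ y, (L ^ 2 + y ^ 2) * (u₁ y * (2 * y * v y / (L ^ 2 + y ^ 2)))|)
        + |∫ y, (L ^ 2 + y ^ 2) * (u₁ y * (d y * v y))|) + |∫ y, (L ^ 2 + y ^ 2) * (u y * (V y * v y))| :=
        (abs_add_le _ _).trans (add_le_add ((abs_add_le _ _).trans (add_le_add (abs_add_le _ _) le_rfl)) le_rfl)
    _ ≤ _ := by nlinarith [e1, e2, e3, e4]

/-- `linForm` is unchanged by a.e. modification of the profile pair. [folklore] -/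
theorem linForm_congr_ae {u u₁ u' u₁' v v₁ : ℝ → ℝ} (L : ℝ) (d V : ℝ → ℝ) (hu : u =ᵐ[volume] u') (hu₁ : u₁ =ᵐ[volume] u₁') :
    linForm L d V u u₁ v v₁ = linForm L d V u' u₁' v v₁ := by
  unfold linForm
  refine integral_congr_ae ?_
  filter_upwards [hu, hu₁] with y hy hy₁
  rw [hy, hy₁]

/-- Additivity of `linForm` in the profile slot (under integrability of both integrands). [folklore] -/
theorem linForm_add_left {u u₁ u' u₁' v v₁ : ℝ → ℝ} (L : ℝ) (d V : ℝ → ℝ)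
    (hi : Integrable (fun y => (L ^ 2 + y ^ 2) * (u₁ y * v₁ y) + 2 * y * (u₁ y * v y) + (L ^ 2 + y ^ 2) * d y * (u₁ y * v y)
        + (L ^ 2 + y ^ 2) * V y * (u y * v y)))
    (hi' : Integrable (fun y => (L ^ 2 + y ^ 2) * (u₁' y * v₁ y) + 2 * y * (u₁' y * v y) + (L ^ 2 + y ^ 2) * d y * (u₁' y * v y)
        + (L ^ 2 + y ^ 2) * V y * (u' y * v y))) :
    linForm L d V (fun y => u y + u' y) (fun y => u₁ y + u₁' y) v v₁ = linForm L d V u u₁ v v₁ + linForm L d V u' u₁' v v₁ := by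
  unfold linForm
  rw [← integral_add hi hi']
  refine integral_congr_ae (Eventually.of_forall fun y => ?_)
  ring

/-- Homogeneity of `linForm` in the profile slot. [folklore] -/
theorem linForm_smul_left {u u₁ v v₁ : ℝ → ℝ} (L : ℝ) (d V : ℝ → ℝ) (c : ℝ) :
    linForm L d V (fun y => c * u y) (fun y => c * u₁ y) v v₁ = c * linForm L d V u u₁ v v₁ := by
  unfold linForm
  rw [← integral_const_mul]
  refine integral_congr_ae (Eventually.of_forall fun y => ?_)
  ring

/-- Additivity of `linForm` in the test slot (under integrability of both integrands). [folklore] -/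
theorem linForm_add_right {u u₁ v v₁ v' v₁' : ℝ → ℝ} (L : ℝ) (d V : ℝ → ℝ)
    (hi : Integrable (fun y => (L ^ 2 + y ^ 2) * (u₁ y * v₁ y) + 2 * y * (u₁ y * v y) + (L ^ 2 + y ^ 2) * d y * (u₁ y * v y)
        + (L ^ 2 + y ^ 2) * V y * (u y * v y)))
    (hi' : Integrable (fun y => (L ^ 2 + y ^ 2) * (u₁ y * v₁' y) + 2 * y * (u₁ y * v' y) + (L ^ 2 + y ^ 2) * d y * (u₁ y * v' y)
        + (L ^ 2 + y ^ 2) * V y * (u y * v' y))) :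
    linForm L d V u u₁ (fun y => v y + v' y) (fun y => v₁ y + v₁' y) = linForm L d V u u₁ v v₁ + linForm L d V u u₁ v' v₁' := by
  unfold linForm
  rw [← integral_add hi hi']
  refine integral_congr_ae (Eventually.of_forall fun y => ?_)
  ring

/-- Homogeneity of `linForm` in the test slot. [folklore] -/
theorem linForm_smul_right {u u₁ v v₁ : ℝ → ℝ} (L : ℝ) (d V : ℝ → ℝ) (c : ℝ) :
    linForm L d V u u₁ (fun y => c * v y) (fun y => c * v₁ y) = c * linForm L d V u u₁ v v₁ := by
  unfold linForm
  rw [← integral_const_mul]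
  refine integral_congr_ae (Eventually.of_forall fun y => ?_)
  ring

end Fixed

end SheetRLinearisedFormBounds
end Summit.NavierStokesRegularity.OSWSelfSimilar

end
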